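import Summits.Ventures.CertifiedManyBodySolver.Observables.PairLROTowerChargedReading
import Summits.Ventures.CertifiedManyBodySolver.Observables.PairLROTowerChargedCells
import HarnessLib

/-!
# OP1-C, part 7: the orbit-state CELL LEAF — one OP1-C certificate per cell of a chemical-potential grid
# covering the certified bracket gives `ObsPairLROCeilingAt t' U n (max_j (M_j + Δ_j C_{q,j})²)`

HONEST FRAMING: first certified bounds on pairing observables; not a superconductivity verdict; a ceiling
route, never presence. Crew hubbard-obs (D-0042), seat hubbard-obs-lit (`literature-prover-hubbard-obs-lit-g7-0`);
the (A3) cells wrapper (RULINGS (eu) d187 / (ex4) d190) re-pointed — as (eu1) instructs («if (A2) changes the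
hypothesis names, re-point by a one-line alias») — at seat hubbard-obs-p1 g9's ORBIT-STATE reading of OP1-C nodes
(`liminf_pairFieldLRO_le_sq_of_onePoint_chargedStationary_orbitState_bound_TT'_near`, PairLROTowerChargedReading, whose
one-cell registry form is `ObsPairLROCeilingAt_of_onePoint_charged_orbitState_bound_sq`, PairLROTowerChargedLeaf; node shape = the OP1-E
orbit-state node + `Re ω̄_ζ(K_L Γ_L X − Γ_L X K_L)`, `K_L = H_L − μ'N̂`, with the LOCAL operator-norm charge bound
`‖N̂_{Λ'}X − XN̂_{Λ'}‖ ≤ C_q` of RULING (ex1) d190). Zero compute; no definition; no named fact; no number; no `sorry`.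

The producer (Stage B) certifies ONE such node per cell `j` of a monotone grid `m : Fin (J+2) → ℝ` with its charged
rows at the cell's grid point `μ'_j`, the word `X_j` (multipliers frozen per cell) and its charge size `C_{q,j}`
(`norm_totalNumberOp_commutator_sum_smul_ladderWord_le`, PairLROTowerChargedOpNorm), and the grid covers the
certified bracket: `m 0 ≤ μ₋(n)`, `μ₊(n) ≤ m (Fin.last (J+1))` (at A0′ = (8, 7/8, 0):
`chemPotBracket_U8_n7o8_tp0_decimal_of_r498_r473_r472`, Certificates/HubbardSquare_U8_n7o8_tp0_chemPotBracket…),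
`μ'_j − Δ_j ≤ m j.castSucc`, `m j.succ ≤ μ'_j + Δ_j`. Then `μ₋(n)` (a supporting slope, `μ₋ ≤ μ₊`) lies in some
closed cell (`exists_mem_Icc_castSucc_succ_of_monotone`, PairLROTowerChargedCells §1; shared endpoints served by
either neighbour), within `Δ_j` of `μ'_j`, and the point leaf applies there:

* §1 `ObsPairLROCeilingAt_of_onePoint_charged_orbitState_gridCells_bound_sq` — PRODUCER FORM (monotone grid,
  finitely many rational grid facts) ⇒ `ObsPairLROCeilingAt t' U n c'` at every
  `c' ≥ max_j (c_j − Δ_j C_{q,j} − A_j + (Σ_σ μ_{jσ})(n/2 − ν_j))²` (stated as `∀ j, … ≤ c'`).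
* §2 `ObsPairLROCeilingAt_of_onePoint_charged_orbitState_near_of_cover` — any family (index type `ι`) of grid
  cells `[μ'_i − Δ_i, μ'_i + Δ_i]` whose union contains a bracket `[μ_lo, μ_hi] ⊇ [μ₋(n), μ₊(n)]`.
Common to all cells: the anchor, the cap `hi`, the point group `S` (`b1gSign = 1`), the window `Λ'` and `L₁`;
per cell: `μ', Δ, c, A, κ, u, ν, μ_σ, C_q` and the word `X`. The raw-`pairField` / `hWq` forms are
PairLROTowerChargedGridCells; the one-cell case of each statement is the point leaf itself.

References: T. Koma, H. Tasaki, J. Stat. Phys. 76 (1994) 745, Theorem 5 [KomaTasaki1994]; D. Ruelle,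
*Statistical Mechanics* (1969) §3.4 [Ruelle1969]; E. H. Lieb, F. Y. Wu, Physica A 321 (2003) 1, §7
[LiebWuPhysicaA2003]; W. Pusz, S. L. Woronowicz, Comm. Math. Phys. 58 (1978) 273, §1 [PuszWoronowicz1978].
-/

noncomputable section

namespace Summit.Ventures.CertifiedManyBodySolver.Observables

open Matrix Complex Finset Literature.MathematicalPhysics.QuantumLattice Literature.Probability.LatticeModels
open Literature.MathematicalPhysics.QuantumLattice.HubbardWave0 ThermodynamicLimit Filter Topology
open Literature.MathematicalPhysics.QuantumManyBody.StateRelaxation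
open Summit.Ventures.CertifiedManyBodySolver.Transport
open scoped ComplexOrder ComplexConjugate BigOperators Matrix.Norms.L2Operator

section LeafCells

variable {tp U n : ℝ} {hi c' : ℚ}

/-! ### §1 Producer form: a monotone grid of cells, one orbit-state OP1-C certificate per cell -/

/-- **OP1-C ORBIT-STATE CELL LEAF (producer form).** At the anchor `(U, n, t')`, `0 ≤ U`, `0 < n < 2`, cap
`e₀(1,t',U,n) ≤ hi`: a monotone grid `m : Fin (J+2) → ℝ` with `m 0 ≤ μ₋(n)`, `μ₊(n) ≤ m (Fin.last (J+1))`; per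
cell `j : Fin (J+1)` a grid point `μ'_j` and half-width `Δ_j` with `μ'_j − Δ_j ≤ m j.castSucc`, `m j.succ ≤ μ'_j + Δ_j`,
constants `c_j, A_j, κ_j ≥ 0, u_j ≥ hi, ν_j`, density multipliers `μ_j`, the charged eom word `X_j ∈ 𝔄_{Λ'}`
(`X_j`, `X_jᴴ` even, `‖N̂_{Λ'}X_j − X_jN̂_{Λ'}‖ ≤ C_{q,j}`) and ONE orbit-state OP1-C node with its rows at `μ'_j` —
exactly the hypotheses of `ObsPairLROCeilingAt_of_onePoint_charged_orbitState_bound_sq` (PairLROTowerChargedLeaf) indexed by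
the cell
(point group `S`, window `Λ' ⊇ pairRegion {0,±e₁,±e₂} 0`, `L₁`, `hInj` common). Conclusion:
`ObsPairLROCeilingAt t' U n c'` at every `c' ≥ max_j (c_j − Δ_j C_{q,j} − A_j + (Σ_σ μ_{jσ})(n/2 − ν_j))²`.
[cite: KomaTasaki1994, Theorem 5] [cite: Ruelle1969, §3.4] [cite: LiebWuPhysicaA2003, §7] -/
theorem ObsPairLROCeilingAt_of_onePoint_charged_orbitState_gridCells_bound_sq (hU : 0 ≤ U) (hn0 : 0 < n)
    (hn2 : n < 2) (hE : energyDensityTT' 1 tp U n ≤ ((hi : ℚ) : ℝ)) {J : ℕ} (m : Fin (J + 2) → ℝ) (hm : Monotone m)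
    (hlo : m 0 ≤ chemPotMinusTT' 1 tp U n) (hhi' : chemPotPlusTT' 1 tp U n ≤ m (Fin.last (J + 1)))
    (μ' Δ : Fin (J + 1) → ℝ) (hleft : ∀ j, μ' j - Δ j ≤ m j.castSucc) (hright : ∀ j, m j.succ ≤ μ' j + Δ j)
    (c A κ u ν Cq : Fin (J + 1) → ℝ) (μ : Fin (J + 1) → Fin 2 → ℝ) (hκ : ∀ j, 0 ≤ κ j)
    (hhi : ∀ j, ((hi : ℚ) : ℝ) ≤ u j)
    {S : Finset (DihedralGroup 4)} (hS : S.Nonempty) (hS1 : ∀ γ ∈ S, b1gSign γ = 1)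
    {Λ' : Finset (Site 2)} (h0 : pairRegion (insert (0 : Site 2) unitSteps) 0 ⊆ Λ')
    (X : Fin (J + 1) → FermionOp Λ')
    (hXeven : ∀ j, X j ∈ carEvenSubalgebra (Finset.univ : Finset (Orb (PolySite Λ'))))
    (hXevenH : ∀ j, (X j)ᴴ ∈ carEvenSubalgebra (Finset.univ : Finset (Orb (PolySite Λ'))))
    (hXq : ∀ j, ‖(totalNumberOp : FermionOp Λ') * X j - X j * totalNumberOp‖ ≤ Cq j) (L₁ : ℕ)
    (hInj : ∀ L : ℕ, L₁ ≤ L → Set.InjOn (Torus.proj (d := 2) L) ↑Λ')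
    (hbound : ∀ j, ∀ (L : ℕ) [NeZero L] (hL : L₁ ≤ L) (ζ : Fock (Orb (FermionTorus 2 L))), star ζ ⬝ᵥ ζ = 1 →
      c j - A j + ∑ σ : Fin 2, μ j σ *
          ((star ζ ⬝ᵥ ((∑ y : FermionTorus 2 L, numberOp y σ) *ᵥ ζ)).re / (L : ℝ) ^ 2 - ν j) +
        κ j * (u j - (star ζ ⬝ᵥ (hubbardTorusTT' L 1 tp U *ᵥ ζ)).re / (L : ℝ) ^ 2) +
        (orbitState (spaceGroupUnitary S) ζ
          ((hubbardTorusTT' L 1 tp U - (μ' j : ℂ) • totalNumber) * fermionEmbed (PolySite.toTorusEmb L (hInj L hL)) (X j) -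
            fermionEmbed (PolySite.toTorusEmb L (hInj L hL)) (X j) *
              (hubbardTorusTT' L 1 tp U - (μ' j : ℂ) • totalNumber))).re ≤
        (orbitState (spaceGroupUnitary S) ζ (fermionEmbed (PolySite.toTorusEmb L (hInj L hL))
          (-(fermionEmbed (PolySite.incl h0)
            (localPairAt (insert (0 : Site 2) unitSteps) dWaveFormFactor 0))))).re)
    (hc' : ∀ j, (c j - Δ j * Cq j - A j + (∑ σ : Fin 2, μ j σ) * (n / 2 - ν j)) ^ 2 ≤ ((c' : ℚ) : ℝ)) :
    ObsPairLROCeilingAt tp U n c' := by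
  have hmp := chemPotMinusTT'_le_chemPotPlusTT' 1 tp hU hn0 hn2
  obtain ⟨j, hj⟩ := exists_mem_Icc_castSucc_succ_of_monotone hm
    (x := chemPotMinusTT' 1 tp U n) ⟨hlo, hmp.trans hhi'⟩
  have hnear : |μ' j - chemPotMinusTT' 1 tp U n| ≤ Δ j :=
    abs_sub_le_iff.2 ⟨by linarith [hj.1, hleft j], by linarith [hj.2, hright j]⟩
  intro ψ hψ hψ1
  have hg : ∀ γ ∈ S, ∀ e ∈ insert (0 : Site 2) unitSteps, dWaveFormFactor (d4Vec γ e) = dWaveFormFactor e :=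
    fun γ hγ e _ => dWaveFormFactor_d4Vec_of_b1gSign_eq_one (hS1 γ hγ) e
  exact (liminf_pairFieldLRO_le_sq_of_onePoint_chargedStationary_orbitState_bound_TT'_near dWaveFormFactor 1 tp
    hU hn0 hn2 (μ j) (hκ j) (hE.trans (hhi j)) ⟨le_rfl, hmp⟩ hnear hS hg h0 (X j) (hXeven j) (hXevenH j) (hXq j)
    L₁ hInj (hbound j) ψ hψ hψ1).trans (hc' j)

/-! ### §2 The envelope over any family of grid cells covering a bracket of the subdifferential -/

/-- **OP1-C ORBIT-STATE ENVELOPE over a cover.** At the anchor `(U, n, t')`, `0 ≤ U`, `0 < n < 2`, cap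
`e₀(1,t',U,n) ≤ hi`: a bracket `μ_lo ≤ μ₋(n)`, `μ₊(n) ≤ μ_hi` and a family of grid cells `[μ'_i − Δ_i, μ'_i + Δ_i]`,
`i : ι`, whose union contains `[μ_lo, μ_hi]`, each with ONE orbit-state OP1-C certificate (rows at `μ'_i`, word `X_i`,
charge size `C_{q,i}`) ⇒ `ObsPairLROCeilingAt t' U n c'` at every
`c' ≥ sup_i (c_i − Δ_i C_{q,i} − A_i + (Σ_σ μ_{iσ})(n/2 − ν_i))²`. [cite: KomaTasaki1994, Theorem 5]
[cite: Ruelle1969, §3.4] [cite: LiebWuPhysicaA2003, §7] -/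
theorem ObsPairLROCeilingAt_of_onePoint_charged_orbitState_near_of_cover (hU : 0 ≤ U) (hn0 : 0 < n)
    (hn2 : n < 2) (hE : energyDensityTT' 1 tp U n ≤ ((hi : ℚ) : ℝ)) {μlo μhi : ℝ}
    (hlo : μlo ≤ chemPotMinusTT' 1 tp U n) (hhi' : chemPotPlusTT' 1 tp U n ≤ μhi)
    {ι : Type*} (μ' Δ : ι → ℝ) (hcover : Set.Icc μlo μhi ⊆ ⋃ i, Set.Icc (μ' i - Δ i) (μ' i + Δ i))
    (c A κ u ν Cq : ι → ℝ) (μ : ι → Fin 2 → ℝ) (hκ : ∀ i, 0 ≤ κ i) (hhi : ∀ i, ((hi : ℚ) : ℝ) ≤ u i)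
    {S : Finset (DihedralGroup 4)} (hS : S.Nonempty) (hS1 : ∀ γ ∈ S, b1gSign γ = 1)
    {Λ' : Finset (Site 2)} (h0 : pairRegion (insert (0 : Site 2) unitSteps) 0 ⊆ Λ')
    (X : ι → FermionOp Λ')
    (hXeven : ∀ i, X i ∈ carEvenSubalgebra (Finset.univ : Finset (Orb (PolySite Λ'))))
    (hXevenH : ∀ i, (X i)ᴴ ∈ carEvenSubalgebra (Finset.univ : Finset (Orb (PolySite Λ'))))
    (hXq : ∀ i, ‖(totalNumberOp : FermionOp Λ') * X i - X i * totalNumberOp‖ ≤ Cq i) (L₁ : ℕ)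
    (hInj : ∀ L : ℕ, L₁ ≤ L → Set.InjOn (Torus.proj (d := 2) L) ↑Λ')
    (hbound : ∀ i, ∀ (L : ℕ) [NeZero L] (hL : L₁ ≤ L) (ζ : Fock (Orb (FermionTorus 2 L))), star ζ ⬝ᵥ ζ = 1 →
      c i - A i + ∑ σ : Fin 2, μ i σ *
          ((star ζ ⬝ᵥ ((∑ y : FermionTorus 2 L, numberOp y σ) *ᵥ ζ)).re / (L : ℝ) ^ 2 - ν i) +
        κ i * (u i - (star ζ ⬝ᵥ (hubbardTorusTT' L 1 tp U *ᵥ ζ)).re / (L : ℝ) ^ 2) +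
        (orbitState (spaceGroupUnitary S) ζ
          ((hubbardTorusTT' L 1 tp U - (μ' i : ℂ) • totalNumber) * fermionEmbed (PolySite.toTorusEmb L (hInj L hL)) (X i) -
            fermionEmbed (PolySite.toTorusEmb L (hInj L hL)) (X i) *
              (hubbardTorusTT' L 1 tp U - (μ' i : ℂ) • totalNumber))).re ≤
        (orbitState (spaceGroupUnitary S) ζ (fermionEmbed (PolySite.toTorusEmb L (hInj L hL))
          (-(fermionEmbed (PolySite.incl h0)
            (localPairAt (insert (0 : Site 2) unitSteps) dWaveFormFactor 0))))).re)
    (hc' : ∀ i, (c i - Δ i * Cq i - A i + (∑ σ : Fin 2, μ i σ) * (n / 2 - ν i)) ^ 2 ≤ ((c' : ℚ) : ℝ)) :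
    ObsPairLROCeilingAt tp U n c' := by
  have hmp := chemPotMinusTT'_le_chemPotPlusTT' 1 tp hU hn0 hn2
  obtain ⟨i, hi⟩ := Set.mem_iUnion.1 (hcover ⟨hlo, hmp.trans hhi'⟩)
  have hnear : |μ' i - chemPotMinusTT' 1 tp U n| ≤ Δ i :=
    abs_sub_le_iff.2 ⟨by linarith [hi.1], by linarith [hi.2]⟩
  intro ψ hψ hψ1
  have hg : ∀ γ ∈ S, ∀ e ∈ insert (0 : Site 2) unitSteps, dWaveFormFactor (d4Vec γ e) = dWaveFormFactor e :=
    fun γ hγ e _ => dWaveFormFactor_d4Vec_of_b1gSign_eq_one (hS1 γ hγ) e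
  exact (liminf_pairFieldLRO_le_sq_of_onePoint_chargedStationary_orbitState_bound_TT'_near dWaveFormFactor 1 tp
    hU hn0 hn2 (μ i) (hκ i) (hE.trans (hhi i)) ⟨le_rfl, hmp⟩ hnear hS hg h0 (X i) (hXeven i) (hXevenH i) (hXq i)
    L₁ hInj (hbound i) ψ hψ hψ1).trans (hc' i)


/-! ### §3 (append, hubbard-obs-p1 g9) The cell-level FAST LAYER and the EXACT-IN-THE-CELL (δ-LIFT) form, D₂ family -/

/-- **OP1-C ORBIT-STATE CELL LEAF, RE-PRICED under ANY certified cap `e₀ ≤ hi`** (cell-level fast layer, `D₂` family): the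
same per-cell nodes (own caps `u_j`, `κ_j ≥ 0`) give the leaf at every
`c′ ≥ max_j (c_j − Δ_j C_{q,j} − A_j + (Σ_σ μ_{jσ})(n/2 − ν_j) + κ_j(u_j − hi))²`. [cite: KomaTasaki1994, Theorem 5] [cite: Ruelle1969, §3.4] -/
theorem ObsPairLROCeilingAt_of_onePoint_charged_orbitState_gridCells_bound_sq_reprice (hU : 0 ≤ U) (hn0 : 0 < n)
    (hn2 : n < 2) (hE : energyDensityTT' 1 tp U n ≤ ((hi : ℚ) : ℝ)) {J : ℕ} (m : Fin (J + 2) → ℝ) (hm : Monotone m)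
    (hlo : m 0 ≤ chemPotMinusTT' 1 tp U n) (hhi' : chemPotPlusTT' 1 tp U n ≤ m (Fin.last (J + 1)))
    (μ' Δ : Fin (J + 1) → ℝ) (hleft : ∀ j, μ' j - Δ j ≤ m j.castSucc) (hright : ∀ j, m j.succ ≤ μ' j + Δ j)
    (c A κ u ν Cq : Fin (J + 1) → ℝ) (μ : Fin (J + 1) → Fin 2 → ℝ) (hκ : ∀ j, 0 ≤ κ j)
    {S : Finset (DihedralGroup 4)} (hS : S.Nonempty) (hS1 : ∀ γ ∈ S, b1gSign γ = 1)
    {Λ' : Finset (Site 2)} (h0 : pairRegion (insert (0 : Site 2) unitSteps) 0 ⊆ Λ')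
    (X : Fin (J + 1) → FermionOp Λ')
    (hXeven : ∀ j, X j ∈ carEvenSubalgebra (Finset.univ : Finset (Orb (PolySite Λ'))))
    (hXevenH : ∀ j, (X j)ᴴ ∈ carEvenSubalgebra (Finset.univ : Finset (Orb (PolySite Λ'))))
    (hXq : ∀ j, ‖(totalNumberOp : FermionOp Λ') * X j - X j * totalNumberOp‖ ≤ Cq j) (L₁ : ℕ)
    (hInj : ∀ L : ℕ, L₁ ≤ L → Set.InjOn (Torus.proj (d := 2) L) ↑Λ')
    (hbound : ∀ j, ∀ (L : ℕ) [NeZero L] (hL : L₁ ≤ L) (ζ : Fock (Orb (FermionTorus 2 L))), star ζ ⬝ᵥ ζ = 1 →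
      c j - A j + ∑ σ : Fin 2, μ j σ *
          ((star ζ ⬝ᵥ ((∑ y : FermionTorus 2 L, numberOp y σ) *ᵥ ζ)).re / (L : ℝ) ^ 2 - ν j) +
        κ j * (u j - (star ζ ⬝ᵥ (hubbardTorusTT' L 1 tp U *ᵥ ζ)).re / (L : ℝ) ^ 2) +
        (orbitState (spaceGroupUnitary S) ζ
          ((hubbardTorusTT' L 1 tp U - (μ' j : ℂ) • totalNumber) * fermionEmbed (PolySite.toTorusEmb L (hInj L hL)) (X j) -
            fermionEmbed (PolySite.toTorusEmb L (hInj L hL)) (X j) *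
              (hubbardTorusTT' L 1 tp U - (μ' j : ℂ) • totalNumber))).re ≤
        (orbitState (spaceGroupUnitary S) ζ (fermionEmbed (PolySite.toTorusEmb L (hInj L hL))
          (-(fermionEmbed (PolySite.incl h0)
            (localPairAt (insert (0 : Site 2) unitSteps) dWaveFormFactor 0))))).re)
    (hc' : ∀ j, (c j - Δ j * Cq j - A j + (∑ σ : Fin 2, μ j σ) * (n / 2 - ν j) + κ j * (u j - ((hi : ℚ) : ℝ))) ^ 2 ≤
      ((c' : ℚ) : ℝ)) :
    ObsPairLROCeilingAt tp U n c' := by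
  refine ObsPairLROCeilingAt_of_onePoint_charged_orbitState_gridCells_bound_sq hU hn0 hn2 hE m hm hlo hhi' μ' Δ hleft
    hright (fun j => c j + κ j * (u j - ((hi : ℚ) : ℝ))) A κ (fun _ => ((hi : ℚ) : ℝ)) ν Cq μ hκ (fun _ => le_rfl) hS
    hS1 h0 X hXeven hXevenH hXq L₁ hInj ?_ ?_
  · intro j L _ hL ζ hζ
    convert hbound j L hL ζ hζ using 1
    ring
  · intro j
    convert hc' j using 2
    ring

/-- **OP1-C ORBIT-STATE CELL LEAF from nodes valid at EVERY chemical potential of their cell** (`D₂` family; the δ-LIFT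
form of a cell certificate, sr-mbsolver-menu-3 MENU3-TLPINCER §8.5): no `C_q`, no `Δ`; leaf at every
`c′ ≥ max_j (c_j − A_j + (Σ_σ μ_{jσ})(n/2 − ν_j))²`. [cite: KomaTasaki1994, Theorem 5] [cite: Ruelle1969, §3.4] -/
theorem ObsPairLROCeilingAt_of_onePoint_charged_orbitState_exactCells_bound_sq (hU : 0 ≤ U) (hn0 : 0 < n)
    (hn2 : n < 2) (hE : energyDensityTT' 1 tp U n ≤ ((hi : ℚ) : ℝ)) {J : ℕ} (m : Fin (J + 2) → ℝ) (hm : Monotone m)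
    (hlo : m 0 ≤ chemPotMinusTT' 1 tp U n) (hhi' : chemPotPlusTT' 1 tp U n ≤ m (Fin.last (J + 1)))
    (c A κ u ν : Fin (J + 1) → ℝ) (μ : Fin (J + 1) → Fin 2 → ℝ) (hκ : ∀ j, 0 ≤ κ j) (hhi : ∀ j, ((hi : ℚ) : ℝ) ≤ u j)
    {S : Finset (DihedralGroup 4)} (hS : S.Nonempty) (hS1 : ∀ γ ∈ S, b1gSign γ = 1)
    {Λ' : Finset (Site 2)} (h0 : pairRegion (insert (0 : Site 2) unitSteps) 0 ⊆ Λ')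
    (X : Fin (J + 1) → FermionOp Λ')
    (hXeven : ∀ j, X j ∈ carEvenSubalgebra (Finset.univ : Finset (Orb (PolySite Λ'))))
    (hXevenH : ∀ j, (X j)ᴴ ∈ carEvenSubalgebra (Finset.univ : Finset (Orb (PolySite Λ')))) (L₁ : ℕ)
    (hInj : ∀ L : ℕ, L₁ ≤ L → Set.InjOn (Torus.proj (d := 2) L) ↑Λ')
    (hbound : ∀ j, ∀ μc ∈ Set.Icc (m j.castSucc) (m j.succ),
      ∀ (L : ℕ) [NeZero L] (hL : L₁ ≤ L) (ζ : Fock (Orb (FermionTorus 2 L))), star ζ ⬝ᵥ ζ = 1 →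
      c j - A j + ∑ σ : Fin 2, μ j σ *
          ((star ζ ⬝ᵥ ((∑ y : FermionTorus 2 L, numberOp y σ) *ᵥ ζ)).re / (L : ℝ) ^ 2 - ν j) +
        κ j * (u j - (star ζ ⬝ᵥ (hubbardTorusTT' L 1 tp U *ᵥ ζ)).re / (L : ℝ) ^ 2) +
        (orbitState (spaceGroupUnitary S) ζ
          ((hubbardTorusTT' L 1 tp U - (μc : ℂ) • totalNumber) * fermionEmbed (PolySite.toTorusEmb L (hInj L hL)) (X j) -
            fermionEmbed (PolySite.toTorusEmb L (hInj L hL)) (X j) *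
              (hubbardTorusTT' L 1 tp U - (μc : ℂ) • totalNumber))).re ≤
        (orbitState (spaceGroupUnitary S) ζ (fermionEmbed (PolySite.toTorusEmb L (hInj L hL))
          (-(fermionEmbed (PolySite.incl h0)
            (localPairAt (insert (0 : Site 2) unitSteps) dWaveFormFactor 0))))).re)
    (hc' : ∀ j, (c j - A j + (∑ σ : Fin 2, μ j σ) * (n / 2 - ν j)) ^ 2 ≤ ((c' : ℚ) : ℝ)) :
    ObsPairLROCeilingAt tp U n c' := by
  have hmp := chemPotMinusTT'_le_chemPotPlusTT' 1 tp hU hn0 hn2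
  obtain ⟨j, hj⟩ := exists_mem_Icc_castSucc_succ_of_monotone hm
    (x := chemPotMinusTT' 1 tp U n) ⟨hlo, hmp.trans hhi'⟩
  have hnear : |chemPotMinusTT' 1 tp U n - chemPotMinusTT' 1 tp U n| ≤ 0 := by rw [sub_self, abs_zero]
  intro ψ hψ hψ1
  have hg : ∀ γ ∈ S, ∀ e ∈ insert (0 : Site 2) unitSteps, dWaveFormFactor (d4Vec γ e) = dWaveFormFactor e :=
    fun γ hγ e _ => dWaveFormFactor_d4Vec_of_b1gSign_eq_one (hS1 γ hγ) e
  have h := liminf_pairFieldLRO_le_sq_of_onePoint_chargedStationary_orbitState_bound_TT'_near dWaveFormFactor 1 tp hU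
    hn0 hn2 (μ j) (hκ j) (hE.trans (hhi j)) ⟨le_rfl, hmp⟩ hnear hS hg h0 (X j) (hXeven j) (hXevenH j)
    (le_refl ‖(totalNumberOp : FermionOp Λ') * X j - X j * totalNumberOp‖) L₁ hInj (hbound j _ hj) ψ hψ hψ1
  rw [zero_mul, sub_zero] at h
  exact h.trans (hc' j)

end LeafCells

end Summit.Ventures.CertifiedManyBodySolver.Observables

end
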